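import Summits.AnomalousDissipation.AnomalousDissipation.Theorems.TwoAndHalfDTwohalfdThesisStubDissipationFloor

/-!
# R2 `stub_dissipationFloorLimsup`: the dissipation floor from a limsup-mean input-power floor

Stub R2 of the line `Sketch` (duhamel-release) for the crux
`Summit.AnomalousDissipation.AnomalousDissipation.Theses.TwoAndHalfD.TwohalfdThesis`
(stmt-AnomalousDissipation-0206); the statement is registered verbatim in the line's checked
skeleton and is consumed by the kernel-checked composition there. It is the twin of D2
`stub_dissipationFloor` with the LIMINF-mean input-power floor replaced by a LIMSUP-mean one.

CONTENT. Let `θ` be a classical solution of the sourced advection–diffusion equation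
`∂ₜθ + u·∇θ = κΔθ + h` on `[0, ∞) × T²` with bounded variance `‖θ(t)‖²_{L²} ≤ B` (`t ≥ 0`) and a
limsup floor `ε ≤ limsup_T T⁻¹∫₀ᵀ P`, `P(t) := ∫ h θ(t)` (input power). Then the limsup-mean
dissipation `⟨κ‖∇θ‖²⟩ = limsup_T T⁻¹∫₀ᵀ κ‖∇θ(t)‖²` (spectral gradient norm
`Torus.eScalarGradNormSq`, `toReal`) is `≥ ε`.

PROOF. (1) The sourced `L²` balance in Cesàro form (`dissipationFloor_timeMean_eq`, D2's file):
`T⁻¹∫₀ᵀ κ‖∇θ‖² = T⁻¹∫₀ᵀ P - (‖θ(T)‖² - ‖θ(0)‖²)/(2T)` for `T > 0`. (2) Hence the dissipation means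
are `≥ T⁻¹∫₀ᵀ P - B/(2T)` and `≤ ‖h‖√B + B/(2T)` (Cauchy–Schwarz `|P| ≤ ‖h‖√B`). (3) Real-variable
bookkeeping (`dissipationFloorLimsup_le_limsup`): the power means are bounded, so
`Filter.frequently_lt_of_lt_limsup` makes them frequently `> ε - δ/2`, while `B/(2T) < δ/2`
eventually; so the dissipation means are frequently `≥ ε - δ` and, being bounded above,
`Filter.le_limsup_of_frequently_le` gives `ε - δ ≤ limsup`, for every `δ > 0`.
Supports stmt-AnomalousDissipation-0206. [folklore: Doering–Foias 2002, §2 (power balance in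
Cesàro form); DEIJ 2022, (1.2)]
-/

noncomputable section

-- the summit path `AnomalousDissipation/AnomalousDissipation` duplicates a namespace component
set_option linter.dupNamespace false

namespace Summit.AnomalousDissipation.AnomalousDissipation.Theorems.TwohalfdThesis

open MeasureTheory Set Filter Topology
open scoped ENNReal NNReal InnerProductSpace
open Literature.Analysis.FunctionSpaces Literature.Analysis.FluidPDE

/-! ## Real-variable bookkeeping: from a limsup floor to a limsup floor -/

/-- **Cesàro bookkeeping (limsup power floor).** If `m T - B/(2T) ≤ n T ≤ K + B/(2T)` for
`T > 0`, `|m T| ≤ K` for `T > 0`, `B ≥ 0` and `ε ≤ limsup m`, then `ε ≤ limsup n` (all along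
`atTop` in `ℝ`; the bounds make both `limsup`s honest): for `δ > 0`, frequently `m T > ε - δ/2`
(`Filter.frequently_lt_of_lt_limsup`, `m` being eventually bounded below) and eventually
`B/(2T) < δ/2`, so frequently `n T ≥ ε - δ` (`Filter.Frequently.and_eventually`), whence
`ε - δ ≤ limsup n` (`Filter.le_limsup_of_frequently_le`, `n` being eventually bounded above).
[folklore] -/
theorem dissipationFloorLimsup_le_limsup {m n : ℝ → ℝ} {ε B K : ℝ} (hB : 0 ≤ B)
    (hlow : ∀ T, 0 < T → m T - B / (2 * T) ≤ n T)
    (hup : ∀ T, 0 < T → n T ≤ K + B / (2 * T))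
    (hm : ∀ T, 0 < T → |m T| ≤ K)
    (hε : ε ≤ limsup m atTop) : ε ≤ limsup n atTop := by
  have hBd : Tendsto (fun T : ℝ => B / (2 * T)) atTop (𝓝 0) :=
    tendsto_const_nhds.div_atTop (tendsto_id.const_mul_atTop two_pos)
  have hm_bdd : IsBoundedUnder (· ≥ ·) atTop m :=
    ⟨-K, (eventually_gt_atTop (0 : ℝ)).mono fun T hT => (abs_le.1 (hm T hT)).1⟩
  have hm_cobdd : IsCoboundedUnder (· ≤ ·) atTop m := hm_bdd.isCoboundedUnder_le
  have hn_bdd : IsBoundedUnder (· ≤ ·) atTop n := by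
    refine ⟨K + B / 2, (eventually_ge_atTop (1 : ℝ)).mono fun T hT => ?_⟩
    have hT0 : 0 < T := by linarith
    have h1 : B / (2 * T) ≤ B / 2 := div_le_div_of_nonneg_left hB two_pos (by linarith)
    exact (hup T hT0).trans (by linarith)
  refine le_of_forall_pos_le_add fun δ hδ => ?_
  rw [← sub_le_iff_le_add]
  have h1 : ∃ᶠ T in atTop, ε - δ / 2 < m T :=
    frequently_lt_of_lt_limsup hm_cobdd (lt_of_lt_of_le (by linarith) hε)
  have h2 : ∀ᶠ T in atTop, B / (2 * T) < δ / 2 := hBd.eventually_lt_const (half_pos hδ)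
  have h3 : ∃ᶠ T in atTop, ε - δ ≤ n T := by
    refine (h1.and_eventually (h2.and (eventually_gt_atTop (0 : ℝ)))).mono fun T hT => ?_
    obtain ⟨hT1, hT2, hT0⟩ := hT
    linarith [hlow T hT0]
  exact le_limsup_of_frequently_le h3 hn_bdd

/-! ## The stub -/

/-- **R2 `stub_dissipationFloorLimsup` (line `Sketch` = duhamel-release, crux
`TwoAndHalfD.TwohalfdThesis`): D2 with a `limsup` power floor.** For a classical solution `θ` of
`∂ₜθ + u·∇θ = κΔθ + h` on `[0, ∞) × T²` (`κ ≥ 0`, `h` smooth) with `‖θ(t)‖²_{L²} ≤ B` for `t ≥ 0`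
and a limsup-mean input-power floor `ε ≤ limsup_T T⁻¹∫₀ᵀ ∫ h θ(t)`, the limsup-mean dissipation
`⟨κ‖∇θ‖²⟩` (spectral gradient norm, `toReal`) is `≥ ε`: the sourced `L²` balance in Cesàro form
(`dissipationFloor_timeMean_eq`) gives `T⁻¹∫₀ᵀ κ‖∇θ‖² ≥ T⁻¹∫₀ᵀ ∫ h θ - B/(2T)` and
`≤ ‖h‖√B + B/(2T)` (Cauchy–Schwarz), and the real-variable bookkeeping
`dissipationFloorLimsup_le_limsup` concludes (Doering–Foias 2002, §2). [folklore] -/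
theorem stub_dissipationFloorLimsup :
    ∀ (κ B ε : ℝ) (u : ℝ → (UnitAddTorus (Fin 2)) → (EuclideanSpace ℝ (Fin 2))) (h : (UnitAddTorus (Fin 2)) → ℝ)
      (θ : ℝ → (UnitAddTorus (Fin 2)) → ℝ),
      0 ≤ κ → Torus.IsSmooth h →
      Torus.IsClassicalScalarTransportForcedOn (Ici 0) κ u (fun _ => h) θ →
      (∀ t, 0 ≤ t → Torus.scalarL2Sq (θ t) ≤ B) →
      ε ≤ limsup (timeMean fun t => ∫ x, h x * θ t x) atTop →
      ε ≤ longTimeAvgSup (fun t => κ * (Torus.eScalarGradNormSq (θ t)).toReal) := by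
  intro κ B ε u h θ _ hh hθ hB hε
  have hB0 : 0 ≤ B := (Torus.scalarL2Sq_nonneg (θ 0)).trans (hB 0 le_rfl)
  -- Cauchy–Schwarz: the input power is bounded by `‖h‖ √B` on `[0, ∞)`
  have hPle : ∀ t, 0 ≤ t → |∫ x, h x * θ t x| ≤ √(Torus.scalarL2Sq h) * √B := by
    intro t ht
    have hθt : Torus.IsSmooth (θ t) := hθ.smooth_scalar.isSmooth_slice (mem_Ici.2 ht)
    have h1 := ScalarAnomalySteadySourceFormal.ColdStartVariance.integral_mul_le_sqrt_mul_sqrt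
      (hh.memLp 2) (hθt.memLp 2)
    have h2 := ScalarAnomalySteadySourceFormal.ColdStartVariance.integral_mul_le_sqrt_mul_sqrt
      (hh.memLp 2).neg (hθt.memLp 2)
    simp only [Pi.neg_apply, neg_mul, integral_neg, neg_sq] at h2
    have h3 : √(∫ x, h x ^ 2) * √(∫ x, θ t x ^ 2) ≤ √(Torus.scalarL2Sq h) * √B :=
      mul_le_mul_of_nonneg_left (Real.sqrt_le_sqrt (hB t ht)) (Real.sqrt_nonneg _)
    rw [abs_le]
    exact ⟨by linarith, by linarith⟩
  have hm : ∀ T, 0 < T →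
      |timeMean (fun t => ∫ x, h x * θ t x) T| ≤ √(Torus.scalarL2Sq h) * √B :=
    fun T hT => abs_timeMean_le hT fun t ht _ => hPle t ht.le
  -- the Cesàro-form balance, bounded variance: lower and upper bounds on the dissipation means
  have hlow : ∀ T, 0 < T → timeMean (fun t => ∫ x, h x * θ t x) T - B / (2 * T) ≤
      timeMean (fun t => κ * (Torus.eScalarGradNormSq (θ t)).toReal) T := by
    intro T hT
    rw [dissipationFloor_timeMean_eq hθ hT]
    have h1 : Torus.scalarL2Sq (θ T) - Torus.scalarL2Sq (θ 0) ≤ B := by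
      linarith [hB T hT.le, Torus.scalarL2Sq_nonneg (θ 0)]
    have h2 : (Torus.scalarL2Sq (θ T) - Torus.scalarL2Sq (θ 0)) / (2 * T) ≤ B / (2 * T) :=
      div_le_div_of_nonneg_right h1 (by positivity)
    linarith
  have hup : ∀ T, 0 < T → timeMean (fun t => κ * (Torus.eScalarGradNormSq (θ t)).toReal) T ≤
      √(Torus.scalarL2Sq h) * √B + B / (2 * T) := by
    intro T hT
    rw [dissipationFloor_timeMean_eq hθ hT]
    have h1 : Torus.scalarL2Sq (θ 0) - Torus.scalarL2Sq (θ T) ≤ B := by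
      linarith [hB 0 le_rfl, Torus.scalarL2Sq_nonneg (θ T)]
    have h2 : (Torus.scalarL2Sq (θ 0) - Torus.scalarL2Sq (θ T)) / (2 * T) ≤ B / (2 * T) :=
      div_le_div_of_nonneg_right h1 (by positivity)
    have h3 : timeMean (fun t => ∫ x, h x * θ t x) T ≤ √(Torus.scalarL2Sq h) * √B :=
      (le_abs_self _).trans (hm T hT)
    have h4 : (Torus.scalarL2Sq (θ 0) - Torus.scalarL2Sq (θ T)) / (2 * T) =
        -((Torus.scalarL2Sq (θ T) - Torus.scalarL2Sq (θ 0)) / (2 * T)) := by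
      ring
    linarith
  unfold longTimeAvgSup
  exact dissipationFloorLimsup_le_limsup hB0 hlow hup hm hε

end Summit.AnomalousDissipation.AnomalousDissipation.Theorems.TwohalfdThesis

end
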